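/-
COR-CM (cells pub-hodgecm / pub-hodgecm2, stage 2 of the Hodge ladder) — TRANSPOSITION SURGE, item (vi) sub-binder S2, TEAM hComp
(coordinator ruling 2026-08-21T18:44:30Z), seat hcomp-compare-2 (comparison maps 2: Liu's `X_K` ↔ the tree's Picard modular surfaces
`P_Γ(V)`), generation 3.  THEOREMS ONLY: no definition, no instance, no named fact, no `variable`, nothing asserted, no proof holes.
Nothing in the tree is edited or restated.  FRAMING: HC_CM is NOT proved; nothing here discharges `hComp`, `hUnif`, `hTree` or B01-S.
-/
import Summits.HodgeConjecture.CorCM.B01.Transposition.Item6PinReachAlong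
import Summits.HodgeConjecture.CorCM.B01.Transposition.HComp.HUnifEngine
import Literature.AlgebraicGeometry.HodgeTheory.ComplexConjugationHolds
import HarnessLib

/-!
# TEAM hComp: the binder `hTree` FROM the binder `hUnif` (converse of `Model.hUnif_of_treeCofan_along`)

`Transposition/Item6PinReachAlong.lean` §5 proves `hUnif` from `hTree` (a cofan by TREE surfaces carries the tree's own ball data).  This
file proves the CONVERSE, so that the two team-facing shapes of TEAM hComp's deliverable are interchangeable in the tree:

* `Model.hTree_of_hUnif_along` — for any embedding family `e` and any carrier `P5`: the binder `hUnif` of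
  `Model.hComp_of_unif_of_alb_along` (`Item6PinReachAlong.lean` :158–169; level by level, Liu's `Sh(G(τ), h_{V(τ),e ι₁})_{fix τ K} ⊗ ℂ` is a
  finite colimit cofan of pieces `X c` carrying ball data `B c` of the `V`-tower shape: `(B c).Hℂ = V.Hm^{ι₁}`, group `ι₁(Γ_c)`) IMPLIES
  the binder `hTree` of `Model.hUnif_of_treeCofan_along` / `Model.pinReach_of_treeCofan_of_alb_along` (:302–311; the same carrier is a
  finite coproduct of TREE surfaces `P_{Γ_c}(V) := Var.scheme (ballQuotientUniformisedDatum_of h₁) h₃ (.pms (pmsCode F ι₁ V (Γ c)))`).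
  KERNEL (ours, glue only): each piece `X c` IS the tree surface `P_{Γ_c}(V)` by the model match `Model.nonempty_iso_pms_of_ballDatum`
  (`AlbaneseSideModelMatch.lean`; Mumford AG I (4.15) via the tree theorem `UnitaryBallModelUnique.exists_iso_of_eq`, read in the real
  Hodge models `exists_isReal_hodgeModel_holds`; anisotropy from `6 ≤ [F:ℚ]`), and the cofan is moved along these isomorphisms.
* `Model.hTree_iff_hUnif_along` — the two binders are EQUIVALENT (this file's direction + `Model.hUnif_of_treeCofan_along`).

Use: once TEAM hComp's `Model.hUnif_holds (h : exists_recordSystem)` (`HComp/HUnifHolds.lean`, pin-1) is a tree theorem,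
`Model.hTree_of_hUnif_along h₁ h₃ _ _ (Model.hUnif_holds h)` inhabits the `hTree` binder of the landed END display
`Model.hc_cm_of_thm418AsPrinted_glue_treeCofan_along` (`Transposition/Item6SupplyPinnedAssemblyAlong.lean` §3, p303619) by name, next to
the `hUnif` junction of its §2.  HC_CM is NOT proved; `hUnif` is not inhabited here.

References: D. Mumford, *Algebraic Geometry I* (1981) §4B (4.15); P. Deligne, *Variétés de Shimura* (Corvallis 1979) §2.1.2.
-/

noncomputable section

open CategoryTheory CategoryTheory.Limits AlgebraicGeometry NumberField
open Literature.AlgebraicGeometry.Motives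
open Literature.AlgebraicGeometry.HodgeTheory
open Literature.AlgebraicGeometry.ShimuraVarieties
open Literature.NumberTheory.Automorphic
open Literature.NumberTheory.Automorphic.PicardCM
open Literature.NumberTheory.Automorphic.Liu2021
open Literature.NumberTheory.Automorphic.Liu2021.AppendixC

namespace Summit.HodgeConjecture.CorCM.Model

/-- **`hTree` FROM `hUnif` along `e ι₁`** (converse of `Model.hUnif_of_treeCofan_along`).  If, level by level below some open compact
`Ksm`, Liu's isometry-type Shimura variety `Sh(G(τ), h_{V(τ),e ι₁})_{fix τ K} ⊗_{(e ι₁)(E)} ℂ` (the carrier `(P5 …).Sh τ (e ι₁)`, App. C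
Rem. C.2) is a finite colimit cofan of pieces `X c` with ball uniformisation data `B c` of the `V`-tower shape (`(B c).Hℂ = V.Hm^{ι₁}`,
`(B c).Γ^{τ₁} = ι₁(Γ_c)` for levels `Γ_c : Level V`) — the binder `hUnif` VERBATIM — then it is a finite coproduct of the TREE surfaces
`P_{Γ_c}(V)` — the binder `hTree` VERBATIM, with the SAME index set and levels.  Glue, ours: each `X c ≅ P_{Γ_c}(V)` by the model match
`Model.nonempty_iso_pms_of_ballDatum` (Mumford AG I (4.15) = tree `UnitaryBallModelUnique.exists_iso_of_eq`, in the real Hodge models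
`exists_isReal_hodgeModel_holds`; `2 < [F:ℚ]` from `6 ≤ [F:ℚ]` gives anisotropy), then pin-1's `Model.nonempty_isColimit_cofan_of_iso` (`HComp/HUnifEngine.lean`).
HC_CM is NOT proved; `hUnif` is not inhabited here. [cite: Mumford1981, §4B (4.15) Corollary, p. 67]
[cite: Deligne1979ShimuraVarieties, §2.1.2] -/
theorem hTree_of_hUnif_along
    (h₁ : BallQuotientUniformised) (h₃ : CMAbelianVarietyRealised)
    (e : ∀ (F : CMField), (F →+* ℂ) → (F →+* ℂ))
    (P5 : ∀ (F : CMField) (ι₁ : F →+* ℂ) (_ : HermSpace3 F ι₁) (_ : CMType F), PropC5Data (maximalRealSubfield F) F)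
    (hUnif : ∀ (F : CMField), IsGalois ℚ F → 6 ≤ Module.finrank ℚ F → ∀ (Φ : CMType F) (ι₁ : F →+* ℂ), ι₁ ∈ Φ.1 →
      ∀ (V : HermSpace3 F ι₁) (τ : maximalRealSubfield F →+* ℝ), C5.IsAbove τ (e F ι₁) →
        ∃ Ksm : Subgroup (P5 F ι₁ V Φ).G, IsOpenCompact Ksm ∧
          ∀ K : C5.OpenCompactSubgroup (P5 F ι₁ V Φ).G, K.1 ≤ Ksm →
            ∃ (Cset : Type) (_ : Fintype Cset) (X : Cset → SchemeOver ℂ) (B : ∀ c, UnitaryBallUniformisationDatum 2 (X c))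
              (Γ : Cset → Level V)
              (inj : ∀ c, X c ⟶ (baseChangeHom (e F ι₁).fieldRange.subtype).obj
                (((P5 F ι₁ V Φ).Sh τ (e F ι₁)).obj (C5.OpenCompactSubgroup.transport ((P5 F ι₁ V Φ).fix τ) K))),
              (∀ c, (B c).Hℂ = V.Hm.map ι₁) ∧
              (∀ c, (B c).Γ.map (Matrix.GeneralLinearGroup.map (B c).τ₁) =
                (Γ c).Γ.map (Matrix.GeneralLinearGroup.map ι₁)) ∧
              Nonempty (IsColimit (Cofan.mk _ inj))) :
    ∀ (F : CMField), IsGalois ℚ F → 6 ≤ Module.finrank ℚ F → ∀ (Φ : CMType F) (ι₁ : F →+* ℂ), ι₁ ∈ Φ.1 →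
      ∀ (V : HermSpace3 F ι₁) (τ : maximalRealSubfield F →+* ℝ), C5.IsAbove τ (e F ι₁) →
        ∃ Ksm : Subgroup (P5 F ι₁ V Φ).G, IsOpenCompact Ksm ∧
          ∀ K : C5.OpenCompactSubgroup (P5 F ι₁ V Φ).G, K.1 ≤ Ksm →
            ∃ (Cset : Type) (_ : Fintype Cset) (Γ : Cset → Level V)
              (inj : ∀ c, Var.scheme (ballQuotientUniformisedDatum_of h₁) h₃ (.pms (pmsCode F ι₁ V (Γ c))) ⟶
                (baseChangeHom (e F ι₁).fieldRange.subtype).obj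
                  (((P5 F ι₁ V Φ).Sh τ (e F ι₁)).obj (C5.OpenCompactSubgroup.transport ((P5 F ι₁ V Φ).fix τ) K))),
              Nonempty (IsColimit (Cofan.mk _ inj)) := by
  intro F hG h6 Φ ι₁ hι V τ hτ
  obtain ⟨Ksm, hKsm, h⟩ := hUnif F hG h6 Φ ι₁ hι V τ hτ
  refine ⟨Ksm, hKsm, fun K hK => ?_⟩
  obtain ⟨Cset, _, X, B, Γ, inj, hH, hΓ, ⟨hcol⟩⟩ := h K hK
  have hF : 2 < Module.finrank ℚ F := by omega
  -- each piece IS a tree surface (model match)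
  let φ : ∀ c, Var.scheme (ballQuotientUniformisedDatum_of h₁) h₃ (.pms (pmsCode F ι₁ V (Γ c))) ≅ X c := fun c =>
    (nonempty_iso_pms_of_ballDatum (ballQuotientUniformisedDatum_of h₁) h₃ exists_isReal_hodgeModel_holds hF (B c) (Γ c)
      (hH c) (hΓ c)).some.symm
  exact ⟨Cset, inferInstance, Γ, fun c => (φ c).hom ≫ inj c, nonempty_isColimit_cofan_of_iso inj hcol φ⟩

/-- **The binders `hTree` and `hUnif` along `e ι₁` are EQUIVALENT** (for every `e`, `P5`): `hTree_of_hUnif_along` and the tree's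
`hUnif_of_treeCofan_along` (`Item6PinReachAlong.lean` §5).  Bookkeeping, ours.  HC_CM is NOT proved; neither side is inhabited here.
[cite: Mumford1981, §4B (4.15) Corollary, p. 67] [cite: Deligne1979ShimuraVarieties, §2.1.2] -/
theorem hTree_iff_hUnif_along
    (h₁ : BallQuotientUniformised) (h₃ : CMAbelianVarietyRealised)
    (e : ∀ (F : CMField), (F →+* ℂ) → (F →+* ℂ))
    (P5 : ∀ (F : CMField) (ι₁ : F →+* ℂ) (_ : HermSpace3 F ι₁) (_ : CMType F), PropC5Data (maximalRealSubfield F) F) :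
    (∀ (F : CMField), IsGalois ℚ F → 6 ≤ Module.finrank ℚ F → ∀ (Φ : CMType F) (ι₁ : F →+* ℂ), ι₁ ∈ Φ.1 →
      ∀ (V : HermSpace3 F ι₁) (τ : maximalRealSubfield F →+* ℝ), C5.IsAbove τ (e F ι₁) →
        ∃ Ksm : Subgroup (P5 F ι₁ V Φ).G, IsOpenCompact Ksm ∧
          ∀ K : C5.OpenCompactSubgroup (P5 F ι₁ V Φ).G, K.1 ≤ Ksm →
            ∃ (Cset : Type) (_ : Fintype Cset) (Γ : Cset → Level V)
              (inj : ∀ c, Var.scheme (ballQuotientUniformisedDatum_of h₁) h₃ (.pms (pmsCode F ι₁ V (Γ c))) ⟶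
                (baseChangeHom (e F ι₁).fieldRange.subtype).obj
                  (((P5 F ι₁ V Φ).Sh τ (e F ι₁)).obj (C5.OpenCompactSubgroup.transport ((P5 F ι₁ V Φ).fix τ) K))),
              Nonempty (IsColimit (Cofan.mk _ inj))) ↔
    (∀ (F : CMField), IsGalois ℚ F → 6 ≤ Module.finrank ℚ F → ∀ (Φ : CMType F) (ι₁ : F →+* ℂ), ι₁ ∈ Φ.1 →
      ∀ (V : HermSpace3 F ι₁) (τ : maximalRealSubfield F →+* ℝ), C5.IsAbove τ (e F ι₁) →
        ∃ Ksm : Subgroup (P5 F ι₁ V Φ).G, IsOpenCompact Ksm ∧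
          ∀ K : C5.OpenCompactSubgroup (P5 F ι₁ V Φ).G, K.1 ≤ Ksm →
            ∃ (Cset : Type) (_ : Fintype Cset) (X : Cset → SchemeOver ℂ) (B : ∀ c, UnitaryBallUniformisationDatum 2 (X c))
              (Γ : Cset → Level V)
              (inj : ∀ c, X c ⟶ (baseChangeHom (e F ι₁).fieldRange.subtype).obj
                (((P5 F ι₁ V Φ).Sh τ (e F ι₁)).obj (C5.OpenCompactSubgroup.transport ((P5 F ι₁ V Φ).fix τ) K))),
              (∀ c, (B c).Hℂ = V.Hm.map ι₁) ∧
              (∀ c, (B c).Γ.map (Matrix.GeneralLinearGroup.map (B c).τ₁) =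
                (Γ c).Γ.map (Matrix.GeneralLinearGroup.map ι₁)) ∧
              Nonempty (IsColimit (Cofan.mk _ inj))) :=
  ⟨hUnif_of_treeCofan_along h₁ h₃ e P5, hTree_of_hUnif_along h₁ h₃ e P5⟩

end Summit.HodgeConjecture.CorCM.Model

end
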